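import Mathlib
import HarnessLib
import Summits.QuantumFields.QCD.Theses.NestedDissectionSea
import Summits.QuantumFields.QCD.Theorems.CoerciveSea.Negative.PinWindow

/-!
# Sketch — crux-ideate round 1, ideator 1, crux `LightQuarkCompletion` (stmt-QuantumFields-18066)

First lemmas of the three idea cards (they need not be proved here; they must elaborate):

* Card A `strong-defect-localisation-branch`: `AdmissibleCornerBound` (Hernández–Jansen–Lüscher
  admissibility gap, global form, tree vocabulary), `UpperPinClause`/`MidSpectrumRare` and the
  target implication `CornerOfMidSpectrumRare` (two-sided pin + mid-spectrum rarity ⇒ `m_crit → 0`).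
* Card L `mass-ladder-continuation`: `RungWeightDomination` (lowering the sea mass never raises the
  phase-quenched weight of a configuration without modes left of the lighter sea point).
* Card C `anomaly-at-the-pinned-corner`: `PinnedRayHandover` (¬ chirality of the J-recentred
  regularisation ⇔ a uniform lattice gap on the ray above J — the hypothesis the anomaly argument eats).
-/

noncomputable section

namespace Summit.QuantumFields.QCD.Cruxes.LightQuarkCompletion.SketchIdeator1

open scoped BigOperators Classical
open Filter MeasureTheory
open Literature.MathematicalPhysics.QuantumLattice Literature.MathematicalPhysics.QuantumFieldTheory
  Literature.Probability.LatticeModels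
open Summit.QuantumFields.QCD.Theorems.CoerciveSeaNegative

local notation "𝔾" => Matrix.specialUnitaryGroup (Fin 3) ℂ

/-! ## Card A — mid-spectrum real Wilson modes live on strong defects -/

/-- **First lemma of Card A (HJL admissibility corner bound, global form).** If every plaquette of
`U` is `ε`-close to the identity in the sense `2 (3 − Re tr U_p) ≤ ε²` (so `‖1 − U_p‖_op ≤ ‖1 − U_p‖_HS ≤ ε`)
with `30 ε < 1`, then the `r = 1` Wilson–Dirac operator has NO real-eigenvalue crossing at any bare mass
`μ` with `|μ + 1| < √(1 − 30ε)`: `det D_W(U, μ, 1) = 0 ⇒ √(1 − 30ε) ≤ |μ + 1|`.  Equivalently every real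
eigenvalue `λ = −μ` of `D_W(U,0,1)` lies within `1 − √(1−30ε) ≤ 15ε + O(ε²)` of the corner `0` or of the
doubler corner `2` (on the branch `μ > −2`).  Source: Hernández–Jansen–Lüscher 1999 (hep-lat/9808010),
the bound `A†A ≥ 1 − 30ε` for `A = 1 − aD_w` (their `s = 0`), plus `σ_min(D(μ)) ≥ σ_min(D(−1)) − |μ+1|`;
Neuberger 2000 (hep-lat/9911004) sharpens the constant.  Finite-dimensional, provable-now (size L). -/
def AdmissibleCornerBound : Prop :=
  ∀ (N : ℕ) [NeZero N] (U : GaugeConfig 4 N 𝔾) (ε μ : ℝ), 0 ≤ ε → 30 * ε < 1 →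
    (∀ (x : TorusSite 4 N) (i j : Fin 4), i ≠ j →
      2 * (3 - (fundamentalRep (Fin 3) (plaquetteHolonomy U x i j)).trace.re) ≤ ε ^ 2) →
    (wilsonDirac (fundamentalRep (Fin 3)) U μ 1).det = 0 →
    Real.sqrt (1 - 30 * ε) ≤ |μ + 1|

/-- **The upper pin clause (b″), VERBATIM from the crux** (companion of the tree's
`CoerciveSeaNegative.PinClause` = (b)): a distance `M > M₀` ABOVE the line the phase-quenched
probability of a negative valence determinant is `≤ 1/8` on odd tori of physical side in `[R, 2R]`. -/
def UpperPinClause (Nf : ℕ) (reg : QCDRegularisation Nf) (M₀ : ℝ) (m : Fin Nf → ℝ) (R : ℝ) : Prop :=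
  ∀ M : ℝ, M₀ < M → ∀ᶠ k : ℕ in Filter.atTop, ∀ S : ℕ, R ≤ reg.a k * (2 * S + 1) →
    reg.a k * (2 * S + 1) ≤ 2 * R →
    let N : ℕ := 2 * S + 1
    let mq : Fin Nf → ℝ := fun f => reg.mcrit k + reg.a k * m f / reg.Zm k
    let wt : GaugeConfig 4 N 𝔾 → ℝ := fun U =>
      ∏ f, ‖fermionDet (wilsonDirac (fundamentalRep (Fin 3)) U (mq f) 1)‖
    (∫ U, (if (fermionDet (wilsonDirac (fundamentalRep (Fin 3)) U
            (reg.mcrit k + reg.a k * M / reg.Zm k) 1)).re < 0 then (1 : ℝ) else 0) * wt U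
        ∂(wilsonMeasure (d := 4) (L := N) (fundamentalRep (Fin 3)) (reg.β k))) /
      (∫ U, wt U ∂(wilsonMeasure (d := 4) (L := N) (fundamentalRep (Fin 3)) (reg.β k))) ≤ (1 / 8 : ℝ)

/-- **Mid-spectrum rarity (the transfer target C⁺ of Card A)**: at ONE sea tuple `m`, for every
`δ, η > 0`, eventually in `k`, on every odd torus of physical side `≤ 2R`, the phase-quenched probability
that `D_W(U,0,1)` has a REAL eigenvalue in `[δ, 2 − δ]` (a crossing at some bare mass `−l`,
`l ∈ [δ, 2−δ]`) is `≤ η`.  Mechanism: such eigenvectors are exponentially localised (lattice-scale rate,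
local HJL gap + Combes–Thomas) on clusters of non-admissible plaquettes; binding one costs cluster Wilson
action `≥ s_bind(δ)`; weak-coupling large deviations make binding clusters `a_k^{4 b₀ s_bind − 4}`-rare per
physical 4-volume (`4 b₀ s > 4 ⇔ s > 1/b₀ = 16.3 (N_f=2), 17.5 (N_f=3)`; instanton `4π² ≈ 39.5`). -/
def MidSpectrumRare (Nf : ℕ) (reg : QCDRegularisation Nf) (m : Fin Nf → ℝ) (R : ℝ) : Prop :=
  ∀ δ η : ℝ, 0 < δ → 0 < η → ∀ᶠ k : ℕ in Filter.atTop, ∀ S : ℕ, reg.a k * (2 * S + 1) ≤ 2 * R →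
    let N : ℕ := 2 * S + 1
    let mq : Fin Nf → ℝ := fun f => reg.mcrit k + reg.a k * m f / reg.Zm k
    let wt : GaugeConfig 4 N 𝔾 → ℝ := fun U =>
      ∏ f, ‖fermionDet (wilsonDirac (fundamentalRep (Fin 3)) U (mq f) 1)‖
    (∫ U, (if (∃ l : ℝ, δ ≤ l ∧ l ≤ 2 - δ ∧
              (wilsonDirac (fundamentalRep (Fin 3)) U (-l) 1).det = 0) then (1 : ℝ) else 0) * wt U
        ∂(wilsonMeasure (d := 4) (L := N) (fundamentalRep (Fin 3)) (reg.β k))) /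
      (∫ U, wt U ∂(wilsonMeasure (d := 4) (L := N) (fundamentalRep (Fin 3)) (reg.β k))) ≤ η

/-- **Card A's claim on the crux (clause `Tendsto reg'.mcrit atTop (nhds 0)`).** The two-sided pin at ONE
sea tuple (`PinClause` = (b), `UpperPinClause` = (b″)), the weak branch `−1 ≤ m_crit(k)` eventually and
mid-spectrum rarity at that tuple force the pinned line to the corner: `m_crit(k) → 0`.  Proof idea (pure
bookkeeping once `MidSpectrumRare` is in hand): if `−m_crit(k_i) ≥ 2δ` along a subsequence, (b) at depth
`M` and (b″) at height `M` (band `a_k M/Z_m → 0`, `PinClause.tendsto_a_div_Zm`) differ by `≥ 1/4 − 1/8`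
on a common torus of side in `[R,2R]`, so with probability `≥ 1/8 − 2η` the parities of the mode counts
below `−m_crit ± a_kM/Z_m` differ, i.e. a real mode of `D_W(U,0,1)` sits in the band `⊂ [δ, 1 + δ]` —
contradicting rarity for `η < 1/16`. -/
def CornerOfMidSpectrumRare : Prop :=
  ∀ (Nf : ℕ) (reg : QCDRegularisation Nf) (M₀ : ℝ) (m : Fin Nf → ℝ) (R : ℝ), 0 < R →
    (∀ᶠ k : ℕ in Filter.atTop, (-1 : ℝ) ≤ reg.mcrit k) →
    PinClause Nf reg M₀ m R → UpperPinClause Nf reg M₀ m R → MidSpectrumRare Nf reg m R →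
    Filter.Tendsto reg.mcrit Filter.atTop (nhds 0)

/-! ## Card L — Hasenbusch's ladder as a proof -/

/-- **First lemma of Card L (rung weight domination).** For one configuration `U` and bare masses
`μ₁ ≤ μ₂`: if every eigenvalue `z` of the massless Wilson operator `D_W(U,0,1)` has `Re z ≥ −μ₁` (no real
or complex mode to the LEFT of the lighter sea point — the early crossers / negative-real-part modes are
the exceptional set), then `|det D_W(U, μ₁, 1)| ≤ |det D_W(U, μ₂, 1)|`: lowering the sea mass never raises
the phase-quenched weight of a non-exceptional configuration, so the rung reweighting factor
`w = ∏_f |det D(μ₁,f)/det D(μ₂,f)| ≤ 1` off the exceptional set (the a-priori bound that makes the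
Kotecký–Preiss activities of a rung bounded).  Proof: `det D(μ) = ∏_z (z + μ)` over the roots of the
characteristic polynomial (ℂ algebraically closed) and `|z + μ|` is non-decreasing in `μ ≥ −Re z`.
Provable-now, size M. -/
def RungWeightDomination : Prop :=
  ∀ (N : ℕ) [NeZero N] (U : GaugeConfig 4 N 𝔾) (μ₁ μ₂ : ℝ), μ₁ ≤ μ₂ →
    (∀ z ∈ (wilsonDirac (fundamentalRep (Fin 3)) U 0 1).charpoly.roots, -μ₁ ≤ z.re) →
    ‖(wilsonDirac (fundamentalRep (Fin 3)) U μ₁ 1).det‖ ≤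
      ‖(wilsonDirac (fundamentalRep (Fin 3)) U μ₂ 1).det‖

/-- **The rung statement (transfer target C⁺ of Card L)**, lattice-gap half: ONE geometric rung.  For a
regularisation, a corner offset `J`, a sea tuple `m` strictly above `J`, a rung fraction `c ∈ (0,1)`:
a uniform lattice gap `Δ` at `m` gives the uniform lattice gap `Δ/2` at every tuple between
`m − c (m − J·1)` and `m` (componentwise).  (The body half — OS data, non-triviality, `T.HasMassGap` — rides
on the same reweighting and is stated in the card, not here.) -/
def OneRungLatticeGap (c : ℝ) : Prop :=
  ∀ (Nf : ℕ) (reg : QCDRegularisation Nf) (J : ℝ) (m : Fin Nf → ℝ), (∀ f, J < m f) →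
    ∀ Δ : ℝ, 0 < Δ → (reg.scheme m 0 0).HasLatticeMassGap Δ →
    ∀ m' : Fin Nf → ℝ, (∀ f, m f - c * (m f - J) ≤ m' f ∧ m' f ≤ m f) →
      (reg.scheme m' 0 0).HasLatticeMassGap (Δ / 2)

/-! ## Card C — anomaly rigidity at the pinned corner -/

/-- **First lemma of Card C (handover on the pinned ray).** For the regularisation re-centred at the jump
offset `J` (`m_crit ↦ m_crit + a_k J / Z_m`), NOT being chiral at zero is EXACTLY a uniform lattice gap
`ε > 0` at every tuple of `reg` strictly above `J·1` — the hypothesis the anomaly-rigidity contradiction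
consumes (cf. tree `RobustYangMillsHandover.Negative.isChiralAtZero_mcrit_shift_iff`,
`not_isChiralAtZero_of_uniformLatticeGap`).  Provable-now, size S. -/
def PinnedRayHandover : Prop :=
  ∀ (Nf : ℕ) (reg : QCDRegularisation Nf) (J : ℝ),
    (¬ ({ reg with mcrit := fun k => reg.mcrit k + reg.a k * J / reg.Zm k } :
          QCDRegularisation Nf).IsChiralAtZero) ↔
      ∃ ε > (0 : ℝ), ∀ m : Fin Nf → ℝ, (∀ f, 0 < m f) →
        (reg.scheme (fun f => J + m f) 0 0).HasLatticeMassGap ε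

/-- Sanity: the handover is the tree's shift lemma read contrapositively (proved here to show the
vocabulary lines up). -/
theorem pinnedRayHandover_holds : PinnedRayHandover := by
  intro Nf reg J
  have hs : ∀ m : Fin Nf → ℝ,
      ({ reg with mcrit := fun k => reg.mcrit k + reg.a k * J / reg.Zm k } :
          QCDRegularisation Nf).scheme m 0 0 = reg.scheme (fun f => J + m f) 0 0 := by
    intro m
    simp only [QCDRegularisation.scheme, QCDScheme.mk.injEq, true_and, and_true]
    funext f k
    ring
  unfold QCDRegularisation.IsChiralAtZero
  simp only [hs]
  push_neg
  constructor
  · rintro ⟨ε, hε, h⟩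
    exact ⟨ε, hε, fun m hm => h m hm⟩
  · rintro ⟨ε, hε, h⟩
    exact ⟨ε, hε, fun m hm => h m hm⟩

end Summit.QuantumFields.QCD.Cruxes.LightQuarkCompletion.SketchIdeator1

end
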